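import Mathlib
import Literature.Geometry.Symplectic.JHolomorphicMap
import Literature.Analysis.Complex.CauchyPompeiu
import Literature.Topology.PlaneTopology.WindingNumber
import Summits.SmoothPoincare4.SmoothPoincare4.Theorems.SullivanDualTameOrBrodyR4HelperAdaptedMap
import Summits.SmoothPoincare4.SmoothPoincare4.Theorems.SullivanDualTameOrBrodyR4HelperSheetDbarInequality
import Summits.SmoothPoincare4.SmoothPoincare4.Theorems.SullivanDualTameOrBrodyR4HelperLocalZeroDichotomy

/-!
# Intersection dichotomy for two sheets of an immersed `J`-holomorphic curve

Crux `TameOrBrodyR4` (stmt-SmoothPoincare4-7826), line `Sketch`, skeleton v16 (injectivity of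
immersed `C¹_loc`-limits of embedded members): the LOCAL analysis at a pair of parameters
`ξa, ξb` of a smooth immersed `J`-holomorphic curve `v : ℂ → ℝ⁴` with `v ξa = v ξb =: x₀` —
stub `helper_pairIsolatedOrCoincide` (PL1); the persistence statement
`helper_pairCoincideOfApprox` (PL2) is in the companion file `…HelperPairCoincide.lean`, which
reuses the lemmas of `namespace PairDichotomy` below.

In the coordinates `Λ` adapted to the first sheet (`helper_adaptedMapInverse`: `Λ` is a local
inverse of the adapted map `E (ζ, ω) = v ζ + ω.re • e + ω.im • J (v ζ) e` near `(ξa, 0)`, so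
that `Λ (v ζ') = (ζ', 0)` for `ζ'` near `ξa`), the second sheet reads `Λ (v ζ) = (a ζ, c ζ)`
for `ζ` near `ξb`, with `a ξb = ξa`, `c ξb = 0`, and `ζ ↦ E (a ζ, c ζ) = v ζ` is
`J`-holomorphic; so the normal coordinate satisfies `‖∂̄ c‖ ≤ M ‖c‖`
(`helper_sheetDbarInequality`), and by `helper_localZeroDichotomy` EITHER `c ≡ 0` near `ξb` —
then `v ζ = E (a ζ, 0) = v (a ζ)`: the sheets COINCIDE through the continuous reparametrisation
`σ := a` — OR `ξb` is an isolated zero of `c` (with non-zero winding number on small circles):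
then `v ζ ≠ v ζ'` for `0 < ‖ζ - ξb‖ ≤ ε` and `‖ζ' - ξa‖ < r`, since `v ζ = v ζ'` would give
`c ζ = (Λ (v ζ')).2 = 0` — the intersection is ISOLATED.

Reference: M. Gromov, *Pseudo holomorphic curves in symplectic manifolds*, Invent. Math. 82
(1985), 2.3; D. McDuff, D. Salamon, *J-holomorphic curves and symplectic topology*, 2nd ed.
(2012), §2.4–2.6 and App. E (intersections of `J`-curves via the local similarity principle).
-/
set_option linter.dupNamespace false

noncomputable section

open Filter Set Metric Literature.Geometry.Symplectic
open scoped ContDiff Topology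

namespace Summit.SmoothPoincare4.SmoothPoincare4.Cruxes.TameOrBrodyR4.Sketch

/-- Local notation for the model space `ℝ⁴ = EuclideanSpace ℝ (Fin 4)`. -/
local notation "E4" => EuclideanSpace ℝ (Fin 4)

namespace PairDichotomy

/-! ### The first sheet in adapted coordinates -/

/-- In coordinates adapted to the first sheet, the first sheet is the `z`-axis:
`Λ (v ζ') = (ζ', 0)` whenever `‖ζ' - ξa‖ < r`. -/
theorem lambda_curve {v : ℂ → E4} {E : ℂ × ℂ → E4} {Λ : E4 → ℂ × ℂ} {ξa : ℂ} {r : ℝ}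
    (hE0 : ∀ ζ : ℂ, E (ζ, 0) = v ζ) (hleft : ∀ p ∈ ball ((ξa, 0) : ℂ × ℂ) r, Λ (E p) = p)
    {ζ' : ℂ} (h : ‖ζ' - ξa‖ < r) : Λ (v ζ') = (ζ', 0) := by
  rw [← hE0]
  apply hleft
  rw [mem_ball, Prod.dist_eq]
  refine max_lt ?_ ?_
  · simpa [dist_eq_norm] using h
  · simpa using (norm_nonneg _).trans_lt h

/-- The adapted coordinate map `Λ` is injective on the ball where it has the left inverse `E`. -/
theorem lambda_injOn {E : ℂ × ℂ → E4} {Λ : E4 → ℂ × ℂ} {x₀ : E4} {δ : ℝ} {S : Set (ℂ × ℂ)}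
    (hright : ∀ x ∈ ball x₀ δ, Λ x ∈ S ∧ E (Λ x) = x) : InjOn Λ (ball x₀ δ) := by
  intro x hx y hy hxy
  rw [← (hright x hx).2, ← (hright y hy).2, hxy]

/-! ### The second sheet in adapted coordinates and the dichotomy -/

/-- The second sheet `ζ ↦ v ζ` near `ξb` read in the coordinates adapted to the first sheet:
`Λ (v ζ) = (a ζ, c ζ)` with `a, c` smooth on a ball `B(ξb, ρ₀)` mapped by `v` into the domain
of `Λ`, `(a ζ, c ζ)` in the ball where `E` inverts `Λ`, `E (a ζ, c ζ) = v ζ`, the composite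
`ζ ↦ E (a ζ, c ζ)` `J`-holomorphic on the ball (it agrees with `v` there), `a ξb = ξa`,
`c ξb = 0`. -/
theorem sheet {J : E4 → E4 →L[ℝ] E4} {v : ℂ → E4} (hv : ContDiff ℝ ∞ v)
    (hvJ : IsJHolomorphicFlat J v) {E : ℂ × ℂ → E4} {Λ : E4 → ℂ × ℂ} {ξa ξb : ℂ}
    {r δ ρ₀ : ℝ} (hE0 : ∀ ζ : ℂ, E (ζ, 0) = v ζ) (hΛ : ContDiffOn ℝ ∞ Λ (ball (v ξa) δ))
    (hleft : ∀ p ∈ ball ((ξa, 0) : ℂ × ℂ) r, Λ (E p) = p)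
    (hright : ∀ x ∈ ball (v ξa) δ, Λ x ∈ ball ((ξa, 0) : ℂ × ℂ) r ∧ E (Λ x) = x)
    (hr : 0 < r) (hx : v ξa = v ξb) (hmaps : ∀ ζ ∈ ball ξb ρ₀, v ζ ∈ ball (v ξa) δ)
    {a c : ℂ → ℂ} (hac : ∀ ζ : ℂ, Λ (v ζ) = (a ζ, c ζ)) :
    ContDiffOn ℝ ∞ a (ball ξb ρ₀) ∧ ContDiffOn ℝ ∞ c (ball ξb ρ₀) ∧
    (∀ ζ ∈ ball ξb ρ₀, (a ζ, c ζ) ∈ ball ((ξa, 0) : ℂ × ℂ) r) ∧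
    (∀ ζ ∈ ball ξb ρ₀, E (a ζ, c ζ) = v ζ) ∧
    (∀ ζ ∈ ball ξb ρ₀, ∀ θ : ℂ,
      fderiv ℝ (fun ζ => E (a ζ, c ζ)) ζ (Complex.I * θ) =
        J (E (a ζ, c ζ)) (fderiv ℝ (fun ζ => E (a ζ, c ζ)) ζ θ)) ∧
    a ξb = ξa ∧ c ξb = 0 := by
  have hΛv : ContDiffOn ℝ ∞ (fun ζ => Λ (v ζ)) (ball ξb ρ₀) :=
    hΛ.comp hv.contDiffOn fun ζ hζ => hmaps ζ hζ
  have ha : ContDiffOn ℝ ∞ a (ball ξb ρ₀) := hΛv.fst.congr fun ζ _ => by rw [hac]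
  have hc : ContDiffOn ℝ ∞ c (ball ξb ρ₀) := hΛv.snd.congr fun ζ _ => by rw [hac]
  have hEac : ∀ ζ ∈ ball ξb ρ₀, E (a ζ, c ζ) = v ζ := fun ζ hζ => by
    rw [← hac]
    exact (hright _ (hmaps ζ hζ)).2
  have hb : Λ (v ξb) = (ξa, 0) := by
    rw [← hx]
    exact lambda_curve hE0 hleft (by simpa using hr)
  rw [hac] at hb
  simp only [Prod.mk.injEq] at hb
  refine ⟨ha, hc, fun ζ hζ => ?_, hEac, fun ζ hζ θ => ?_, hb.1, hb.2⟩
  · rw [← hac]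
    exact (hright _ (hmaps ζ hζ)).1
  · have heq : (fun ζ => E (a ζ, c ζ)) =ᶠ[𝓝 ζ] v := by
      filter_upwards [isOpen_ball.mem_nhds hζ] with ζ' hζ' using hEac ζ' hζ'
    rw [heq.fderiv_eq, hEac ζ hζ]
    exact hvJ ζ θ

/-- The local dichotomy for the normal coordinate `c` of the second sheet at `ξb` (scalar
reduction `‖∂̄ c‖ ≤ M ‖c‖` + local similarity principle): either `c` vanishes identically near
`ξb`, or `ξb` is an isolated zero of `c` with non-zero winding number on a small circle. The
radius `ρ < ρ₀` records the disc of validity of the `∂̄`-inequality. -/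
theorem dichotomy {J : E4 → E4 →L[ℝ] E4} (hJs : ContDiff ℝ ∞ J) {v : ℂ → E4}
    (hv : ContDiff ℝ ∞ v) (hvJ : IsJHolomorphicFlat J v) {E : ℂ × ℂ → E4} {Λ : E4 → ℂ × ℂ}
    {ξa ξb : ℂ} {r δ B ρ₀ : ℝ} (hE : ContDiff ℝ ∞ E) (hE0 : ∀ ζ : ℂ, E (ζ, 0) = v ζ)
    (hhol : ∀ ζ α β : ℂ, J (v ζ) (fderiv ℝ E (ζ, 0) (α, β)) =
      fderiv ℝ E (ζ, 0) (Complex.I * α, Complex.I * β))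
    (hΛ : ContDiffOn ℝ ∞ Λ (ball (v ξa) δ))
    (hleft : ∀ p ∈ ball ((ξa, 0) : ℂ × ℂ) r, Λ (E p) = p)
    (hright : ∀ x ∈ ball (v ξa) δ, Λ x ∈ ball ((ξa, 0) : ℂ × ℂ) r ∧ E (Λ x) = x)
    (hlow : ∀ p ∈ ball ((ξa, 0) : ℂ × ℂ) r, ∀ q : ℂ × ℂ, ‖q‖ ≤ B * ‖fderiv ℝ E p q‖)
    (hr : 0 < r) (hx : v ξa = v ξb) (hρ₀ : 0 < ρ₀)
    (hmaps : ∀ ζ ∈ ball ξb ρ₀, v ζ ∈ ball (v ξa) δ)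
    {a c : ℂ → ℂ} (hac : ∀ ζ : ℂ, Λ (v ζ) = (a ζ, c ζ)) :
    ∃ ρ : ℝ, 0 < ρ ∧ ρ < ρ₀ ∧
      ((∀ᶠ ζ in 𝓝 ξb, c ζ = 0) ∨
        ∃ ε : ℝ, 0 < ε ∧ ε < ρ / 2 ∧ (∀ z : ℂ, 0 < ‖z - ξb‖ → ‖z - ξb‖ ≤ ε → c z ≠ 0) ∧
          Literature.Topology.PlaneTopology.wind
            (fun t => c (Literature.Topology.PlaneTopology.circleLoop ξb ε t)) ≠ 0) := by
  obtain ⟨ha, hc, hin, -, hJhol, -, hc0⟩ := sheet hv hvJ hE0 hΛ hleft hright hr hx hmaps hac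
  have hhol' : ∀ ζ α β : ℂ, J (E (ζ, 0)) (fderiv ℝ E (ζ, 0) (α, β)) =
      fderiv ℝ E (ζ, 0) (Complex.I * α, Complex.I * β) := fun ζ α β => by
    rw [hE0]
    exact hhol ζ α β
  obtain ⟨ρ, M, hρ, hρρ₀, -, hbound⟩ := helper_sheetDbarInequality J hJs E hE ξa r B hr hhol'
    hlow a c ξb ρ₀ hρ₀ ha hc hin hJhol
  refine ⟨ρ, hρ, hρρ₀, ?_⟩
  have hc2 : ContDiffOn ℝ ∞ c (ball ξb (2 * (ρ / 2))) :=
    hc.mono (ball_subset_ball (by linarith))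
  have hb2 : ∀ ζ ∈ closedBall ξb (ρ / 2),
      ‖Literature.Analysis.Complex.dbarAlong 1 c ζ‖ ≤ M * ‖c ζ‖ := fun ζ hζ =>
    hbound ζ (closedBall_subset_closedBall (by linarith) hζ)
  exact helper_localZeroDichotomy c ξb (ρ / 2) M (half_pos hρ) hc2 hb2 hc0

/-! ### The two alternatives -/

/-- Alternative (i) (`c ≡ 0` near `ξb`) gives COINCIDENCE of the sheets through `σ := a`:
`v ζ = E (a ζ, c ζ) = E (a ζ, 0) = v (a ζ)` on a small ball about `ξb`. -/
theorem coincide_of_eventually {v : ℂ → E4} {E : ℂ × ℂ → E4} {Λ : E4 → ℂ × ℂ} {ξa ξb : ℂ}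
    {δ ρ₀ : ℝ} {S : Set (ℂ × ℂ)} (hE0 : ∀ ζ : ℂ, E (ζ, 0) = v ζ)
    (hright : ∀ x ∈ ball (v ξa) δ, Λ x ∈ S ∧ E (Λ x) = x) (hρ₀ : 0 < ρ₀)
    (hmaps : ∀ ζ ∈ ball ξb ρ₀, v ζ ∈ ball (v ξa) δ)
    {a c : ℂ → ℂ} (hac : ∀ ζ : ℂ, Λ (v ζ) = (a ζ, c ζ)) (ha : ContinuousOn a (ball ξb ρ₀))
    (hab : a ξb = ξa) (hev : ∀ᶠ ζ in 𝓝 ξb, c ζ = 0) :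
    ∃ (σ : ℂ → ℂ) (N : Set ℂ), IsOpen N ∧ ξb ∈ N ∧ ContinuousOn σ N ∧
      (∀ ζ ∈ N, v ζ = v (σ ζ)) ∧ σ ξb = ξa := by
  obtain ⟨τ, hτ, hτc⟩ := Metric.eventually_nhds_iff.1 hev
  refine ⟨a, ball ξb (min τ ρ₀), isOpen_ball, mem_ball_self (lt_min hτ hρ₀),
    ha.mono (ball_subset_ball (min_le_right _ _)), fun ζ hζ => ?_, hab⟩
  have hζτ : c ζ = 0 := hτc (lt_of_lt_of_le (mem_ball.1 hζ) (min_le_left _ _))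
  have hζρ : ζ ∈ ball ξb ρ₀ := ball_subset_ball (min_le_right _ _) hζ
  calc v ζ = E (Λ (v ζ)) := ((hright _ (hmaps ζ hζρ)).2).symm
    _ = E (a ζ, 0) := by rw [hac, hζτ]
    _ = v (a ζ) := hE0 _

/-- Alternative (ii) (`ξb` an isolated zero of `c`) gives an ISOLATED intersection: if
`0 < ‖ζ - ξb‖ ≤ ε`, `‖ζ' - ξa‖ < r` and `v ζ = v ζ'`, then `c ζ = (Λ (v ζ')).2 = 0`. -/
theorem isolated_of_zeroFree {v : ℂ → E4} {E : ℂ × ℂ → E4} {Λ : E4 → ℂ × ℂ} {ξa ξb : ℂ}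
    {r ε : ℝ} (hE0 : ∀ ζ : ℂ, E (ζ, 0) = v ζ)
    (hleft : ∀ p ∈ ball ((ξa, 0) : ℂ × ℂ) r, Λ (E p) = p)
    {a c : ℂ → ℂ} (hac : ∀ ζ : ℂ, Λ (v ζ) = (a ζ, c ζ))
    (hzf : ∀ z : ℂ, 0 < ‖z - ξb‖ → ‖z - ξb‖ ≤ ε → c z ≠ 0) :
    ∀ ζ : ℂ, 0 < ‖ζ - ξb‖ → ‖ζ - ξb‖ ≤ ε → ∀ ζ' : ℂ, ‖ζ' - ξa‖ < r → v ζ ≠ v ζ' := by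
  intro ζ h0 hε ζ' hζ' heq
  refine hzf ζ h0 hε ?_
  have h := hac ζ
  rw [heq, lambda_curve hE0 hleft hζ'] at h
  simp only [Prod.mk.injEq] at h
  exact h.2.symm

/-- (PL1) for abstract adapted data `(E, Λ, r, δ, B)` at `ξa`. -/
theorem isolatedOrCoincide {J : E4 → E4 →L[ℝ] E4} (hJs : ContDiff ℝ ∞ J) {v : ℂ → E4}
    (hv : ContDiff ℝ ∞ v) (hvJ : IsJHolomorphicFlat J v) {E : ℂ × ℂ → E4} {Λ : E4 → ℂ × ℂ}
    {ξa ξb : ℂ} {r δ B : ℝ} (hE : ContDiff ℝ ∞ E) (hE0 : ∀ ζ : ℂ, E (ζ, 0) = v ζ)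
    (hhol : ∀ ζ α β : ℂ, J (v ζ) (fderiv ℝ E (ζ, 0) (α, β)) =
      fderiv ℝ E (ζ, 0) (Complex.I * α, Complex.I * β))
    (hΛ : ContDiffOn ℝ ∞ Λ (ball (v ξa) δ))
    (hleft : ∀ p ∈ ball ((ξa, 0) : ℂ × ℂ) r, Λ (E p) = p)
    (hright : ∀ x ∈ ball (v ξa) δ, Λ x ∈ ball ((ξa, 0) : ℂ × ℂ) r ∧ E (Λ x) = x)
    (hlow : ∀ p ∈ ball ((ξa, 0) : ℂ × ℂ) r, ∀ q : ℂ × ℂ, ‖q‖ ≤ B * ‖fderiv ℝ E p q‖)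
    (hr : 0 < r) (hδ : 0 < δ) (hx : v ξa = v ξb) :
    (∃ (σ : ℂ → ℂ) (N : Set ℂ), IsOpen N ∧ ξb ∈ N ∧ ContinuousOn σ N ∧
      (∀ ζ ∈ N, v ζ = v (σ ζ)) ∧ σ ξb = ξa) ∨
    (∃ ε r' : ℝ, 0 < ε ∧ 0 < r' ∧ ∀ ζ : ℂ, 0 < ‖ζ - ξb‖ → ‖ζ - ξb‖ ≤ ε →
      ∀ ζ' : ℂ, ‖ζ' - ξa‖ < r' → v ζ ≠ v ζ') := by
  -- a ball about `ξb` mapped by `v` into the domain of `Λ`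
  obtain ⟨ρ₀, hρ₀, hmaps⟩ : ∃ ρ₀ : ℝ, 0 < ρ₀ ∧ ∀ ζ ∈ ball ξb ρ₀, v ζ ∈ ball (v ξa) δ := by
    obtain ⟨ρ₀, hρ₀, h⟩ := Metric.continuousAt_iff.1 (hv.continuous.continuousAt (x := ξb)) δ hδ
    exact ⟨ρ₀, hρ₀, fun ζ hζ => by rw [mem_ball, hx]; exact h (mem_ball.1 hζ)⟩
  have hac : ∀ ζ : ℂ, Λ (v ζ) = ((fun ζ => (Λ (v ζ)).1) ζ, (fun ζ => (Λ (v ζ)).2) ζ) :=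
    fun ζ => rfl
  obtain ⟨ρ, -, -, hdich⟩ :=
    dichotomy hJs hv hvJ hE hE0 hhol hΛ hleft hright hlow hr hx hρ₀ hmaps hac
  rcases hdich with hev | ⟨ε, hε, -, hzf, -⟩
  · obtain ⟨ha, -, -, -, -, hab, -⟩ := sheet hv hvJ hE0 hΛ hleft hright hr hx hmaps hac
    exact Or.inl (coincide_of_eventually hE0 hright hρ₀ hmaps hac ha.continuousOn hab hev)
  · exact Or.inr ⟨ε, r, hε, hr, isolated_of_zeroFree hE0 hleft hac hzf⟩

end PairDichotomy

/-- (PL1) intersection dichotomy for two sheets of one immersed `J`-holomorphic curve through a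
common point: the sheets coincide near the second parameter (through a continuous
reparametrisation onto the first), or the intersection is isolated. -/
theorem helper_pairIsolatedOrCoincide (J : E4 → E4 →L[ℝ] E4) (hJs : ContDiff ℝ ∞ J)
    (hJ2 : ∀ x v, J x (J x v) = -v) (v : ℂ → E4) (hv : ContDiff ℝ ∞ v)
    (hvJ : IsJHolomorphicFlat J v) (himm : ∀ ξ : ℂ, Function.Injective (fderiv ℝ v ξ)) :
    ∀ ξa ξb : ℂ, v ξa = v ξb →
      (∃ (σ : ℂ → ℂ) (N : Set ℂ), IsOpen N ∧ ξb ∈ N ∧ ContinuousOn σ N ∧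
        (∀ ζ ∈ N, v ζ = v (σ ζ)) ∧ σ ξb = ξa) ∨
      (∃ ε r' : ℝ, 0 < ε ∧ 0 < r' ∧ ∀ ζ : ℂ, 0 < ‖ζ - ξb‖ → ‖ζ - ξb‖ ≤ ε →
        ∀ ζ' : ℂ, ‖ζ' - ξa‖ < r' → v ζ ≠ v ζ') := by
  intro ξa ξb hx
  obtain ⟨e, Λ, r, δ, B, hr, hδ, -, hΛ, hleft, hright, hlow⟩ :=
    helper_adaptedMapInverse J hJs hJ2 v hv hvJ ξa (himm ξa)
  obtain ⟨hE, hE0, hhol⟩ := helper_adaptedMapHol J hJs hJ2 v hv hvJ e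
  exact PairDichotomy.isolatedOrCoincide hJs hv hvJ hE hE0 hhol hΛ hleft hright hlow hr hδ hx

end Summit.SmoothPoincare4.SmoothPoincare4.Cruxes.TameOrBrodyR4.Sketch
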